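import Summits.CriticalPhenomena.PercolationContinuityZ3.Theorems.Transplant.FKConnectivityAllQTwoClusterPinning
import Literature.Probability.Percolation.TwoClusterConditionalAssociation
import HarnessLib

/-!
# van den Berg–Häggström–Kahn's Theorem 1.4 AT LEVEL TWO (node `TwoClusterCrossNegAssocPos`, NOT asserted): under `{a ↮ c} ∩ {k = 2}` the
# edge clusters `C_a` and `C_c` are negatively correlated — and this single statement yields, in the kernel, positive association of the
# two-cluster law (CA₂), the two-cluster four-point inequality (FP2), edge dominance at the seed and opposite-seed edge negative correlation

Support file (`--supports stmt-CriticalPhenomena-4575`), FK sub-lane `prim-bschramm-fk-1` (gen 14) of the post-continuity programme;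
builds on p205010 (kernel theorem, internal audit signed; external expert review pending).  Definitions (`clusterVerts`, two indicator
functionals, the predicate `TwoClusterCrossNegAssocOn`, one `@[conjecture]` node — NOT asserted), no named facts, no sorries; standard axioms.

THE PUBLISHED THEOREM (tree: `Literature/Probability/Percolation/TwoClusterConditionalAssociation.lean`, van den Berg–Häggström–Kahn 2006,
Thm. 1.4, PROVED there from Thm. 1.5/1.3): for Bernoulli percolation and increasing functions `F` of the open edge cluster `C_s` and `G` of
`C_t`, `E[F G | s ↮ t] ≤ E[F | s ↮ t]·E[G | s ↮ t]` (`BHK2006_twoClusterConditionalAssociation.negCorrelation`); eq. (2) is the case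
`F = 1{s ↔ a}`, `G = 1{t ↔ b}`.
THE NODE OF THIS FILE: the SAME inequality with `{s ↮ t}` replaced by `E = {a ↮ c} ∩ {k = 2}` (exactly two open clusters):
`TwoClusterCrossNegAssocOn V`: `P(E)·∫_E F(C_a)G(C_c) ≤ (∫_E F(C_a))·(∫_E G(C_c))` for all monotone `F, G : Set (Sym2 V) → ℝ`.
The printed proof does NOT survive the level constraint (given `C_a = W` the rest is a random CONNECTED spanning subgraph of `G[V ∖ V(W)]`, not
fresh Bernoulli, and `E[G(C_c) | C_a = W]` is not monotone in `W`), and the companion Thm. 1.3/1.5 (same-cluster positive association) is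
FALSE at level two for edge functionals (`…TwoClusterEdgePairs.lean`: two edges at `a` have covariance of either sign).  Nevertheless the
CROSS inequality holds in every cell of an exact census (fk-1 g14, memo bschramm/FROM-fk-1-g14-EDGE-DOMINANCE.md §7: all connected graphs
on ≤ 5 vertices × 3 palettes × all `(a, c)`, random 6-vertex graphs; `F, G` ranging over single edges, pairs and triples of edges, vertex
connections, edge∧vertex conjunctions, unions, triples, edge-count and vertex-count thresholds: 0 violations in 71.7·10⁶ `(F, G)`-cells);
the level-3 analogue (`{a ↮ c} ∩ {k = 3}`) is FALSE (620 / 124,560 for single seed edges), while the all-level analogue for the `q`-weighted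
(FK) measures `φ_{w,q}(· | a ↮ c)`, `q ∈ {¼, ½, 1, 2, 4}`, has 0 violations (seed edges, n ≤ 5) — for `q = 1` it is the printed theorem.
KERNEL CONSEQUENCES (at level two `V(C_c) = V ∖ V(C_a)`, so an increasing VERTEX functional of `C_a` is a decreasing functional of `C_c`):
* **`twoClusterAssocOn_of_crossNegAssocOn : TwoClusterCrossNegAssocOn V → TwoClusterAssocOn V`** (CA₂, g13's node; `F = 1{V(C_a) ∈ 𝒰}`,
  `G = 1{V ∖ V(C_c) ∉ 𝒱}`), hence **`twoClusterFourPointOn_of_crossNegAssocOn`** (FP2 = vdBHK eq. (2) at level two);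
* **`edgeVertexPosCorr_of_crossNegAssocOn`**: `Cov(F(C_a), 1{V(C_a) ∈ 𝒱} | E) ≥ 0` for every monotone edge functional `F` — same-cluster
  positive association survives at level two as soon as ONE of the two functionals is a vertex functional; with `F = 1{av ∈ C_a}` this is edge
  dominance at the seed in conditional form (`edgeDomCond_of_crossNegAssocOn`, cf. node `TwoClusterEdgeDomPos`);
* **`oppSeedNegCorrCond_of_crossNegAssocOn`**: `P(av, cy open, E)·P(E) ≤ P(av open, E)·P(cy open, E)` (cf. node `TwoClusterSeedNegCorrPos`).
So the two-cluster corner of the `q < 1` column (fk-1 g12–g14) is ONE conjecture: vdBHK's Theorem 1.4 at fixed level `k = 2`.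
[cite: VandenbergHaggstromKahn2005, Thm. 1.4 (p. 7); eq. (2) (p. 2); Thm. 1.5 (p. 7, eq. (9)); Thm. 1.3 (p. 6)]
[cite: Grimmett2006, §1.2 eq. (1.1) (p. 4); §3.9 (pp. 63–65)] [cite: KozmaNitzan2024, Thm. 1, eq. (6) (pp. 7–8)]
-/

noncomputable section

namespace Summit.CriticalPhenomena.PercolationContinuityZ3.Theorems

namespace FK

open MeasureTheory Set Literature.Probability.LatticeModels Literature.Probability.Percolation
open scoped Classical

variable {V : Type*} [Fintype V]

/-! ### Vertex set of an edge cluster -/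

omit [Fintype V] in
/-- The vertex set of the edge cluster `C` of `s`: `s` together with the ends of the edges of `C`.
[cite: VandenbergHaggstromKahn2005, §1 p. 3 (definition of C_s)] -/
def clusterVerts (s : V) (C : Set (Sym2 V)) : Set V := {v | v = s ∨ ∃ e ∈ C, v ∈ e}

omit [Fintype V] in
/-- `clusterVerts` is monotone. [folklore] -/
theorem clusterVerts_mono (s : V) {C C' : Set (Sym2 V)} (h : C ⊆ C') : clusterVerts s C ⊆ clusterVerts s C' :=
  fun _ hv => hv.imp id fun ⟨e, he, hve⟩ => ⟨e, h he, hve⟩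

omit [Fintype V] in
/-- The vertex set of the open edge cluster is the open cluster. [cite: VandenbergHaggstromKahn2005, §1 p. 3] -/
theorem clusterVerts_openEdgeCluster (ω : BondConfig V) (s : V) : clusterVerts s (openEdgeCluster ω s) = openCluster ω s := by
  ext v
  simp only [clusterVerts, openCluster, mem_setOf_eq]
  rw [reachable_iff_exists_mem_openEdgeCluster]

/-! ### The node: vdBHK Theorem 1.4 at level two -/

/-- **Cross negative association at level two on the vertex type `V`**: for all weights, all `a, c` and all monotone `F, G : Set (Sym2 V) → ℝ`,
`P(E)·∫_E F(C_a)·G(C_c) dP ≤ (∫_E F(C_a) dP)·(∫_E G(C_c) dP)`, `E = {a ↮ c} ∩ {k = 2}`, `C_x` = open edge cluster of `x` — van den Berg–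
Häggström–Kahn's Theorem 1.4 with the extra conditioning on exactly two clusters (denominator-free form, as the tree's vendored Thm. 1.4).
[cite: VandenbergHaggstromKahn2005, Thm. 1.4 (p. 7)] [cite: Grimmett2006, §1.2 eq. (1.1) (p. 4)] -/
def TwoClusterCrossNegAssocOn (V : Type*) [Fintype V] : Prop :=
  ∀ (w : Sym2 V → unitInterval) (a c : V) (F G : Set (Sym2 V) → ℝ), Monotone F → Monotone G →
    (prodBernoulli w).real (twoClusterEv a c) *
        (∫ ω in twoClusterEv a c, F (openEdgeCluster ω a) * G (openEdgeCluster ω c) ∂(prodBernoulli w)) ≤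
      (∫ ω in twoClusterEv a c, F (openEdgeCluster ω a) ∂(prodBernoulli w)) *
        (∫ ω in twoClusterEv a c, G (openEdgeCluster ω c) ∂(prodBernoulli w))

/-- **vdBHK Theorem 1.4 at level two, on every finite weighted graph.**  CONJECTURE-SHAPED STATEMENT, NOT asserted.  Evidence (fk-1 g14,
exact; memo §7): 0 violations in 71.7·10⁶ `(F, G)`-cells on all weighted graphs with ≤ 5 vertices and random 6-vertex graphs (edge, edge-pair,
edge-triple, vertex, mixed, union and threshold functionals); the printed (no-level) statement is the theorem
`BHK2006_twoClusterConditionalAssociation.negCorrelation`; the level-3 analogue is false.  Implies `TwoClusterAssocPos`, `TwoClusterFourPointPos`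
and the conditional forms of `TwoClusterEdgeDomPos`, `TwoClusterSeedNegCorrPos`. [cite: VandenbergHaggstromKahn2005, Thm. 1.4 (p. 7)] -/
@[conjecture] def TwoClusterCrossNegAssocPos : Prop := ∀ n : ℕ, TwoClusterCrossNegAssocOn (Fin n)

/-! ### The two indicator functionals -/

/-- `F_𝒰(C) = 1{clusterVerts a C ∈ 𝒰}`. [folklore] -/
def upInd (a : V) (𝒰 : Set (Set V)) (C : Set (Sym2 V)) : ℝ := if clusterVerts a C ∈ 𝒰 then 1 else 0

/-- `G_𝒱(C) = 1{(clusterVerts c C)ᶜ ∉ 𝒱}` — an increasing vertex functional of the OTHER cluster, read as a functional of `C_c`. [folklore] -/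
def coInd (c : V) (𝒱 : Set (Set V)) (C : Set (Sym2 V)) : ℝ := if (clusterVerts c C)ᶜ ∈ 𝒱 then 0 else 1

omit [Fintype V] in
/-- `F_𝒰` is monotone for an up-set `𝒰`. [folklore] -/
theorem monotone_upInd (a : V) {𝒰 : Set (Set V)} (h𝒰 : IsUpperSet 𝒰) : Monotone (upInd a 𝒰) := by
  intro C C' hCC'
  unfold upInd
  by_cases h : clusterVerts a C ∈ 𝒰
  · rw [if_pos h, if_pos (h𝒰 (clusterVerts_mono a hCC') h)]
  · rw [if_neg h]; split_ifs <;> norm_num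

omit [Fintype V] in
/-- `G_𝒱` is monotone for an up-set `𝒱`. [folklore] -/
theorem monotone_coInd (c : V) {𝒱 : Set (Set V)} (h𝒱 : IsUpperSet 𝒱) : Monotone (coInd c 𝒱) := by
  intro C C' hCC'
  unfold coInd
  by_cases h : (clusterVerts c C')ᶜ ∈ 𝒱
  · rw [if_pos h, if_pos (h𝒱 (compl_subset_compl.2 (clusterVerts_mono c hCC')) h)]
  · rw [if_neg h]; split_ifs <;> norm_num

omit [Fintype V] in
/-- `F_𝒰(C_a(ω)) = 1_{C_a ∈ 𝒰}(ω)`. [folklore] -/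
theorem upInd_openEdgeCluster (a : V) (𝒰 : Set (Set V)) :
    (fun ω : BondConfig V => upInd a 𝒰 (openEdgeCluster ω a)) = (clusterIn a 𝒰).indicator 1 := by
  funext ω
  unfold upInd
  rw [clusterVerts_openEdgeCluster]
  by_cases h : openCluster ω a ∈ 𝒰
  · rw [if_pos h, indicator_of_mem (show ω ∈ clusterIn a 𝒰 from h), Pi.one_apply]
  · rw [if_neg h, indicator_of_notMem (show ω ∉ clusterIn a 𝒰 from h)]

/-- On `E`: `G_𝒱(C_c(ω)) = 1_{C_a ∉ 𝒱}(ω)`. [cite: Grimmett2006, §1.2 eq. (1.1) (p. 4)] -/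
theorem coInd_openEdgeCluster_eqOn (a c : V) (𝒱 : Set (Set V)) :
    EqOn (fun ω : BondConfig V => coInd c 𝒱 (openEdgeCluster ω c)) ((clusterIn a 𝒱)ᶜ.indicator 1) (twoClusterEv a c) := by
  intro ω hE
  simp only
  unfold coInd
  rw [clusterVerts_openEdgeCluster, compl_openCluster_eq_of_mem_twoClusterEv hE]
  by_cases h : openCluster ω a ∈ 𝒱
  · rw [if_pos h, indicator_of_notMem (show ω ∉ (clusterIn a 𝒱)ᶜ from fun h' => h' h)]
  · rw [if_neg h, indicator_of_mem (show ω ∈ (clusterIn a 𝒱)ᶜ from h), Pi.one_apply]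

/-! ### From the node to inequalities between masses -/

/-- `1{e ∈ C}`. [folklore] -/
def memInd (e : Sym2 V) (C : Set (Sym2 V)) : ℝ := if e ∈ C then 1 else 0

omit [Fintype V] in
/-- `1{e ∈ C}` is monotone. [folklore] -/
theorem monotone_memInd (e : Sym2 V) : Monotone (memInd e) := by
  intro C C' hCC'
  unfold memInd
  by_cases h : e ∈ C
  · rw [if_pos h, if_pos (hCC' h)]
  · rw [if_neg h]; split_ifs <;> norm_num

omit [Fintype V] in
/-- For a non-loop pair at the seed, `1{av ∈ C_a(ω)} = 1_{av open}(ω)`. [cite: VandenbergHaggstromKahn2005, §1 p. 3] -/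
theorem memInd_openEdgeCluster {a v : V} (hav : a ≠ v) :
    (fun ω : BondConfig V => memInd s(a, v) (openEdgeCluster ω a)) = {ω : BondConfig V | s(a, v) ∈ ω}.indicator 1 := by
  funext ω
  unfold memInd
  rw [mk_mem_openEdgeCluster_iff ω hav]
  by_cases h : s(a, v) ∈ ω
  · rw [if_pos h, indicator_of_mem (show ω ∈ {ω : BondConfig V | s(a, v) ∈ ω} from h), Pi.one_apply]
  · rw [if_neg h, indicator_of_notMem (show ω ∉ {ω : BondConfig V | s(a, v) ∈ ω} from h)]

/-- **The node read on events**: if on `E` the functionals `F(C_a)`, `G(C_c)` are the indicators of events `A`, `B`, then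
`P(E)·P(E ∩ A ∩ B) ≤ P(E ∩ A)·P(E ∩ B)`. [cite: VandenbergHaggstromKahn2005, Thm. 1.4 (p. 7); eq. (2) (p. 2)] -/
theorem real_ineq_of_crossNegAssocOn (h : TwoClusterCrossNegAssocOn V) (w : Sym2 V → unitInterval) (a c : V)
    {F G : Set (Sym2 V) → ℝ} (hF : Monotone F) (hG : Monotone G) {A B : Set (BondConfig V)}
    (hA : EqOn (fun ω : BondConfig V => F (openEdgeCluster ω a)) (A.indicator 1) (twoClusterEv a c))
    (hB : EqOn (fun ω : BondConfig V => G (openEdgeCluster ω c)) (B.indicator 1) (twoClusterEv a c)) :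
    (prodBernoulli w).real (twoClusterEv a c) * (prodBernoulli w).real (twoClusterEv a c ∩ (A ∩ B)) ≤
      (prodBernoulli w).real (twoClusterEv a c ∩ A) * (prodBernoulli w).real (twoClusterEv a c ∩ B) := by
  have hmE : MeasurableSet (twoClusterEv a c : Set (BondConfig V)) := measurableSet_bond _
  have hind : ∀ S : Set (BondConfig V), ∫ ω in twoClusterEv a c, S.indicator (1 : BondConfig V → ℝ) ω ∂(prodBernoulli w) =
      (prodBernoulli w).real (twoClusterEv a c ∩ S) := fun S => by
    rw [setIntegral_indicator (measurableSet_bond S)]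
    simp only [Pi.one_apply, setIntegral_const, smul_eq_mul, mul_one]
  have key := h w a c F G hF hG
  have hAB : EqOn (fun ω : BondConfig V => F (openEdgeCluster ω a) * G (openEdgeCluster ω c)) ((A ∩ B).indicator 1) (twoClusterEv a c) := by
    intro ω hω
    have h1 := hA hω
    have h2 := hB hω
    simp only at h1 h2 ⊢
    rw [h1, h2]
    exact (congrFun (Set.inter_indicator_one (s := A) (t := B) (M₀ := ℝ)) ω).symm
  rw [setIntegral_congr_fun hmE hAB, setIntegral_congr_fun hmE hA, setIntegral_congr_fun hmE hB, hind, hind, hind] at key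
  exact key

/-! ### CA₂ and FP2 -/

/-- **vdBHK Thm. 1.4 at level two ⇒ positive association of the two-cluster law** (`TwoClusterCrossNegAssocOn V → TwoClusterAssocOn V`):
`F = 1{V(C_a) ∈ 𝒰}`, `G = 1{V ∖ V(C_c) ∉ 𝒱}`; on `E`, `V ∖ V(C_c) = V(C_a)`, so the cross inequality `P(E)P(𝒰 ∖ 𝒱, E) ≤ P(𝒰, E)P(𝒱ᶜ, E)`
is `P(𝒰, E)P(𝒱, E) ≤ P(𝒰 ∩ 𝒱, E)P(E)`. [cite: VandenbergHaggstromKahn2005, Thm. 1.4 (p. 7); Thm. 1.5 (p. 7)] -/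
theorem twoClusterAssocOn_of_crossNegAssocOn (h : TwoClusterCrossNegAssocOn V) : TwoClusterAssocOn V := by
  intro w a c 𝒰 𝒱 h𝒰 h𝒱
  set μ := prodBernoulli w with hμ
  set E : Set (BondConfig V) := twoClusterEv a c with hE
  have key := real_ineq_of_crossNegAssocOn h w a c (monotone_upInd a h𝒰) (monotone_coInd c h𝒱)
    (A := clusterIn a 𝒰) (B := (clusterIn a 𝒱)ᶜ) (fun ω _ => congrFun (upInd_openEdgeCluster a 𝒰) ω) (coInd_openEdgeCluster_eqOn a c 𝒱)
  have hmV : MeasurableSet (clusterIn a 𝒱 : Set (BondConfig V)) := measurableSet_bond _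
  -- masses of the complements
  have h1 : μ.real (E ∩ (clusterIn a 𝒱)ᶜ) = μ.real E - μ.real (clusterIn a 𝒱 ∩ E) := by
    have := measureReal_inter_add_sdiff (μ := μ) (s := E) hmV
    rw [inter_comm (clusterIn a 𝒱)]
    rw [show (E ∩ (clusterIn a 𝒱)ᶜ : Set (BondConfig V)) = E \ clusterIn a 𝒱 from rfl]; linarith
  have h2 : μ.real (E ∩ (clusterIn a 𝒰 ∩ (clusterIn a 𝒱)ᶜ)) = μ.real (clusterIn a 𝒰 ∩ E) - μ.real (clusterIn a 𝒰 ∩ clusterIn a 𝒱 ∩ E) := by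
    have := measureReal_inter_add_sdiff (μ := μ) (s := clusterIn a 𝒰 ∩ E) hmV
    rw [show (E ∩ (clusterIn a 𝒰 ∩ (clusterIn a 𝒱)ᶜ) : Set (BondConfig V)) = (clusterIn a 𝒰 ∩ E) \ clusterIn a 𝒱 by ext ω; simp only [mem_inter_iff, mem_compl_iff, mem_sdiff]; tauto,
      show (clusterIn a 𝒰 ∩ clusterIn a 𝒱 ∩ E : Set (BondConfig V)) = clusterIn a 𝒰 ∩ E ∩ clusterIn a 𝒱 by ext ω; simp only [mem_inter_iff]; tauto]
    linarith
  have h3 : μ.real (E ∩ clusterIn a 𝒰) = μ.real (clusterIn a 𝒰 ∩ E) := by rw [inter_comm]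
  rw [h1, h2, h3] at key
  have hX : 0 ≤ μ.real (clusterIn a 𝒰 ∩ clusterIn a 𝒱 ∩ E) := measureReal_nonneg
  nlinarith [key]

/-- **vdBHK Thm. 1.4 at level two ⇒ the two-cluster four-point inequality** (= vdBHK eq. (2) at level two; through CA₂ and g13's
`twoClusterFourPointOn_of_assocOn`). [cite: VandenbergHaggstromKahn2005, eq. (2) (p. 2)] [cite: KozmaNitzan2024, Thm. 1, eq. (6) (pp. 7–8)] -/
theorem twoClusterFourPointOn_of_crossNegAssocOn (h : TwoClusterCrossNegAssocOn V) : TwoClusterFourPointOn V :=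
  twoClusterFourPointOn_of_assocOn (twoClusterAssocOn_of_crossNegAssocOn h)

/-- **`TwoClusterCrossNegAssocPos → TwoClusterAssocPos`.** [cite: VandenbergHaggstromKahn2005, Thm. 1.4 (p. 7)] -/
theorem twoClusterAssocPos_of_crossNegAssocPos (h : TwoClusterCrossNegAssocPos) : TwoClusterAssocPos :=
  fun n => twoClusterAssocOn_of_crossNegAssocOn (h n)

/-- **`TwoClusterCrossNegAssocPos → TwoClusterFourPointPos`.** [cite: VandenbergHaggstromKahn2005, eq. (2) (p. 2)]
[cite: KozmaNitzan2024, Thm. 1 (p. 7)] -/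
theorem twoClusterFourPointPos_of_crossNegAssocPos (h : TwoClusterCrossNegAssocPos) : TwoClusterFourPointPos :=
  fun n => twoClusterFourPointOn_of_crossNegAssocOn (h n)

/-! ### Edge dominance at the seed and opposite-seed negative correlation (conditional forms) -/

/-- **vdBHK Thm. 1.4 at level two ⇒ edge dominance at the seed (conditional form)**: for a non-loop pair `av` and an up-set `𝒰`,
`P(av open, E)·P(C_a ∈ 𝒰, E) ≤ P(E)·P(av open, C_a ∈ 𝒰, E)` — the law of `C_a` given `E` and `av` open dominates the law given `E`
(`F = 1{av ∈ C_a}`, `G = 1{V ∖ V(C_c) ∉ 𝒰}`; cf. node `TwoClusterEdgeDomPos`). [cite: VandenbergHaggstromKahn2005, Thm. 1.4 (p. 7)]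
[cite: Grimmett2006, Thm. (2.1) (p. 24)] -/
theorem edgeDomCond_of_crossNegAssocOn (h : TwoClusterCrossNegAssocOn V) (w : Sym2 V → unitInterval) {a v : V} (hav : a ≠ v) (c : V)
    {𝒰 : Set (Set V)} (h𝒰 : IsUpperSet 𝒰) :
    (prodBernoulli w).real ({ω | s(a, v) ∈ ω} ∩ twoClusterEv a c) * (prodBernoulli w).real (clusterIn a 𝒰 ∩ twoClusterEv a c) ≤
      (prodBernoulli w).real (twoClusterEv a c) * (prodBernoulli w).real ({ω | s(a, v) ∈ ω} ∩ clusterIn a 𝒰 ∩ twoClusterEv a c) := by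
  set μ := prodBernoulli w with hμ
  set E : Set (BondConfig V) := twoClusterEv a c with hE
  have key := real_ineq_of_crossNegAssocOn h w a c (monotone_memInd s(a, v)) (monotone_coInd c h𝒰)
    (A := {ω : BondConfig V | s(a, v) ∈ ω}) (B := (clusterIn a 𝒰)ᶜ) (fun ω _ => congrFun (memInd_openEdgeCluster hav) ω)
    (coInd_openEdgeCluster_eqOn a c 𝒰)
  have hmU : MeasurableSet (clusterIn a 𝒰 : Set (BondConfig V)) := measurableSet_bond _
  have h1 : μ.real (E ∩ (clusterIn a 𝒰)ᶜ) = μ.real E - μ.real (clusterIn a 𝒰 ∩ E) := by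
    have := measureReal_inter_add_sdiff (μ := μ) (s := E) hmU
    rw [inter_comm (clusterIn a 𝒰)]
    rw [show (E ∩ (clusterIn a 𝒰)ᶜ : Set (BondConfig V)) = E \ clusterIn a 𝒰 from rfl]; linarith
  have h2 : μ.real (E ∩ ({ω : BondConfig V | s(a, v) ∈ ω} ∩ (clusterIn a 𝒰)ᶜ)) =
      μ.real ({ω : BondConfig V | s(a, v) ∈ ω} ∩ E) - μ.real ({ω : BondConfig V | s(a, v) ∈ ω} ∩ clusterIn a 𝒰 ∩ E) := by
    have := measureReal_inter_add_sdiff (μ := μ) (s := {ω : BondConfig V | s(a, v) ∈ ω} ∩ E) hmU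
    rw [show (E ∩ ({ω : BondConfig V | s(a, v) ∈ ω} ∩ (clusterIn a 𝒰)ᶜ) : Set (BondConfig V)) =
        ({ω : BondConfig V | s(a, v) ∈ ω} ∩ E) \ clusterIn a 𝒰 by ext ω; simp only [mem_inter_iff, mem_compl_iff, mem_sdiff, mem_setOf_eq]; tauto,
      show ({ω : BondConfig V | s(a, v) ∈ ω} ∩ clusterIn a 𝒰 ∩ E : Set (BondConfig V)) = {ω : BondConfig V | s(a, v) ∈ ω} ∩ E ∩ clusterIn a 𝒰 by
        ext ω; simp only [mem_inter_iff, mem_setOf_eq]; tauto]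
    linarith
  have h3 : μ.real (E ∩ {ω : BondConfig V | s(a, v) ∈ ω}) = μ.real ({ω : BondConfig V | s(a, v) ∈ ω} ∩ E) := by rw [inter_comm]
  rw [h1, h2, h3] at key
  nlinarith [key, (measureReal_nonneg : 0 ≤ μ.real ({ω : BondConfig V | s(a, v) ∈ ω} ∩ clusterIn a 𝒰 ∩ E))]

/-- **vdBHK Thm. 1.4 at level two ⇒ opposite-seed edge negative correlation (conditional form)**: for non-loop pairs `av`, `cy`,
`P(av, cy open, E)·P(E) ≤ P(av open, E)·P(cy open, E)` (`F = 1{av ∈ C_a}`, `G = 1{cy ∈ C_c}`; cf. node `TwoClusterSeedNegCorrPos`).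
[cite: VandenbergHaggstromKahn2005, Thm. 1.4 (p. 7); eq. (2) (p. 2)] [cite: Grimmett2006, §3.9 eq. (3.94) (p. 63)] -/
theorem oppSeedNegCorrCond_of_crossNegAssocOn (h : TwoClusterCrossNegAssocOn V) (w : Sym2 V → unitInterval) {a v c y : V} (hav : a ≠ v)
    (hcy : c ≠ y) :
    (prodBernoulli w).real ({ω | s(a, v) ∈ ω} ∩ ({ω | s(c, y) ∈ ω} ∩ twoClusterEv a c)) * (prodBernoulli w).real (twoClusterEv a c) ≤
      (prodBernoulli w).real ({ω | s(a, v) ∈ ω} ∩ twoClusterEv a c) * (prodBernoulli w).real ({ω | s(c, y) ∈ ω} ∩ twoClusterEv a c) := by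
  have key := real_ineq_of_crossNegAssocOn h w a c (monotone_memInd s(a, v)) (monotone_memInd s(c, y))
    (A := {ω : BondConfig V | s(a, v) ∈ ω}) (B := {ω : BondConfig V | s(c, y) ∈ ω}) (fun ω _ => congrFun (memInd_openEdgeCluster hav) ω)
    (fun ω _ => congrFun (memInd_openEdgeCluster hcy) ω)
  rw [show (twoClusterEv a c ∩ ({ω : BondConfig V | s(a, v) ∈ ω} ∩ {ω : BondConfig V | s(c, y) ∈ ω}) : Set (BondConfig V)) =
      {ω | s(a, v) ∈ ω} ∩ ({ω | s(c, y) ∈ ω} ∩ twoClusterEv a c) by ext ω; simp only [mem_inter_iff, mem_setOf_eq]; tauto,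
    inter_comm (twoClusterEv a c) {ω : BondConfig V | s(a, v) ∈ ω}, inter_comm (twoClusterEv a c) {ω : BondConfig V | s(c, y) ∈ ω}] at key
  linarith

end FK

end Summit.CriticalPhenomena.PercolationContinuityZ3.Theorems

end
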